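import Literature.Computability.AlgebraicComplexity.LMR13Prop351Holds
import HarnessLib

/-!
# LMR13 §3.5: the stabiliser dimension of `P_Λ` and the dimension of its orbit closure, all odd `n ≥ 3`

[topic Computability/AlgebraicComplexity]

Landsberg–Manivel–Ressayre 2013, §3.5 (journal p. 481; arXiv:1004.4802 `p0008.txt:L92`–`p0009.txt:L4`): "the
contribution of the remaining terms is isomorphic with `𝔤𝔩_n ⊕ 𝔤𝔩_n`. In particular it has dimension `2n²`,
which is one more than the dimension of the stabilizer of `[det_n]`. This implies that `\overline{GL(W)·P_Λ}` has
codimension one in `\overline{GL(W)·det_n}`." Hüttenhain–Lairez 2016, Lemma 2, is the `n = 3` instance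
(dimension of the stabiliser Lie algebra of their `P₂`: `17`; of `det₃`: `16`).

This file records the UNCONDITIONAL numerical corollaries of the cell's (X3b) programme for every odd
`n ≥ 3` — they were so far available only through the assembly `SkewAdj.LMR2013_prop_3_5_1_of_blocks`
(hypotheses) or at `n = 3` (`finrank_glAnn_pLambda_three`, `affineDimension_orbitClosure_pLambda_three_add_one`):

* `finrank_glAnn_pLambda_le` / `finrank_glAnn_pLambda_eq` : `dim 𝔤𝔩(W)_{P_Λ} = 2n² − 1` (affine annihilator; the
  printed `2n²` is projective, i.e. includes the Euler scalar) — upper bound from the block theorems (I)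
  `SkewAdj.pLambda_blockI` (val-lit-t13) and (III) `SkewAdj.skewPart_linAct_skew_eq_zero` (val-lit-t12) through
  `SkewAdj.finrank_glAnn_pLambda_le_of_blocks` (val-lit-p7), lower bound `finrank_glAnn_pLambda_ge` (val-lit-t12);
* `finrank_glAnn_pLambda_eq_finrank_glAnn_detPoly_add_one` : "one more than the stabilizer of `det_n`"
  (`finrank_glAnn_detPoly`, val-lit-t13);
* `finrank_glTangent_pLambda` : `dim 𝔤𝔩(W)·P_Λ = n⁴ + 1 − 2n²` (rank–nullity);
* `affineDimension_orbitClosure_pLambda_add_one`, `affineDimension_orbitClosure_pLambda`,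
  `ringKrullDim_orbitCoordRing_pLambda` : `dim \overline{GL(W)·P_Λ} = n⁴ + 1 − 2n² = dim \overline{GL(W)·det_n} − 1`
  (val-lit-t11's `affineDimension_orbitClosure_pLambda_add_one_eq_of_finrank_glAnn_le`,
  `affineDimension_orbitClosure_eq_finrank_glTangent`, and the Krull-dimension bridge of `DetOrbitClosureDimension`).

Theorems only; no definition, no named fact. Route deviation (cell memo `X3b-ELEMENTARY-ROUTE-t10g4.md`: sparse skew
test points and `2n² − 1` coordinate functionals instead of the printed `GL_n`-module count of `End(Λ² ⊕ S²)`) is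
disclosed in the block files. Honest framing: dimension bookkeeping of a published 2013 computation; VP ≠ VNP is NOT
proved and nothing here is progress on it.

## References

* [LandsbergManivelRessayre2013] J. M. Landsberg, L. Manivel, N. Ressayre, *Hypersurfaces with degenerate duals and
  the geometric complexity theory program*, Comment. Math. Helv. 88 (2013) 469–484, §3.5 and Proposition 3.5.1 (p. 481).
* [HuttenhainLairez2016] J. Hüttenhain, P. Lairez, *The boundary of the orbit of the 3 by 3 determinant polynomial*,
  C. R. Math. Acad. Sci. Paris 354 (2016) 931–935, Lemma 2.
* [Burgisser2024Completeness] P. Bürgisser, arXiv:2406.06217, §7.2 (`dim Ω_n = n⁴ − 2n² + 2`).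
-/

noncomputable section

namespace Literature.Computability.AlgebraicComplexity

/-- **`dim 𝔤𝔩(W)_{P_Λ} ≤ 2n² − 1`** for every odd `n ≥ 3` (LMR 2013 §3.5: the stabiliser of `[P_Λ]` "has
dimension `2n²`" projectively): `n = 3` by `finrank_glAnn_pLambda_three`, `n = 2h+1 ≥ 5` by
`SkewAdj.finrank_glAnn_pLambda_le_of_blocks` fed with the block theorems `SkewAdj.pLambda_blockI` and
`SkewAdj.skewPart_linAct_skew_eq_zero`. [cite: LandsbergManivelRessayre2013, §3.5 (p. 481)] -/
theorem finrank_glAnn_pLambda_le {n : ℕ} (hn : Odd n) (h3 : 3 ≤ n) :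
    Module.finrank ℂ (glAnn (pLambda n)) ≤ 2 * n ^ 2 - 1 := by
  obtain ⟨h, rfl⟩ := hn
  have hh : 1 ≤ h := by omega
  have hn' : 2 * h + 1 = h + h + 1 := by ring
  rw [hn']
  rcases Nat.lt_or_ge h 2 with hlt | h2
  · have h1 : h = 1 := by omega
    subst h1
    show Module.finrank ℂ (glAnn (pLambda 3)) ≤ 2 * 3 ^ 2 - 1
    rw [finrank_glAnn_pLambda_three]
    norm_num
  · exact SkewAdj.finrank_glAnn_pLambda_le_of_blocks hh (SkewAdj.pLambda_blockI h h2)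
      (fun X hX hΦ hΨ hΨ12 A hA => SkewAdj.skewPart_linAct_skew_eq_zero h2 hX hΦ hΨ hΨ12 hA)

/-- **`dim 𝔤𝔩(W)_{P_Λ} = 2n² − 1`** for every odd `n ≥ 3` — the stabiliser count of LMR 2013 §3.5
("isomorphic with `𝔤𝔩_n ⊕ 𝔤𝔩_n` … dimension `2n²`", one less for the affine annihilator, which excludes the Euler
scalar); `n = 3`: `17` = Hüttenhain–Lairez 2016 Lemma 2. Lower bound `finrank_glAnn_pLambda_ge` (the explicit
family), upper bound `finrank_glAnn_pLambda_le`.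
[cite: LandsbergManivelRessayre2013, §3.5 (p. 481)] [cite: HuttenhainLairez2016, Lemma 2] -/
theorem finrank_glAnn_pLambda_eq {n : ℕ} (hn : Odd n) (h3 : 3 ≤ n) :
    Module.finrank ℂ (glAnn (pLambda n)) = 2 * n ^ 2 - 1 :=
  le_antisymm (finrank_glAnn_pLambda_le hn h3) (finrank_glAnn_pLambda_ge n h3)

/-- **"one more than the dimension of the stabilizer of `[det_n]`"** (LMR 2013 §3.5, arXiv `p0008.txt:L92–93`):
`dim 𝔤𝔩(W)_{P_Λ} = dim 𝔤𝔩(W)_{det_n} + 1` for every odd `n ≥ 3` (`2n² − 1 = (2n² − 2) + 1`,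
`finrank_glAnn_detPoly`). [cite: LandsbergManivelRessayre2013, §3.5 (p. 481)] -/
theorem finrank_glAnn_pLambda_eq_finrank_glAnn_detPoly_add_one {n : ℕ} (hn : Odd n) (h3 : 3 ≤ n) :
    Module.finrank ℂ (glAnn (pLambda n)) = Module.finrank ℂ (glAnn (detPoly (Fin n) ℂ)) + 1 := by
  rw [finrank_glAnn_pLambda_eq hn h3, finrank_glAnn_detPoly]
  have h1 : 1 ≤ n ^ 2 := Nat.one_le_pow _ _ (by omega)
  omega

/-- **`dim 𝔤𝔩(W)·P_Λ = n⁴ + 1 − 2n²`** (the tangent space of the orbit at `P_Λ`) for every odd `n ≥ 3`, by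
rank–nullity `finrank_glTangent_add_finrank_glAnn` and `finrank_glAnn_pLambda_eq`.
[cite: LandsbergManivelRessayre2013, §3.5 (p. 481)] -/
theorem finrank_glTangent_pLambda {n : ℕ} (hn : Odd n) (h3 : 3 ≤ n) :
    Module.finrank ℂ (glTangent (pLambda n)) = n ^ 4 + 1 - 2 * n ^ 2 := by
  have h := finrank_glTangent_add_finrank_glAnn (pLambda n)
  rw [Fintype.card_prod, Fintype.card_fin, finrank_glAnn_pLambda_eq hn h3] at h
  have h4 : (n * n) ^ 2 = n ^ 2 * n ^ 2 := by ring
  have h4' : n ^ 4 = n ^ 2 * n ^ 2 := by ring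
  rw [h4] at h
  rw [h4']
  have h1 : 3 ≤ n ^ 2 := le_trans h3 (Nat.le_self_pow (by norm_num) n)
  have h2 : 2 * n ^ 2 ≤ n ^ 2 * n ^ 2 + 1 := by nlinarith [h1]
  omega

/-- **`\overline{GL(W)·P_Λ}` has codimension one in `\overline{GL(W)·det_n}`** (LMR 2013 Prop. 3.5.1, second
clause; arXiv `p0008.txt:L93–94`), as the unconditional dimension identity
`dim Δ(P_Λ) + 1 = dim Δ(det_n)` for every odd `n ≥ 3` — val-lit-t11's
`affineDimension_orbitClosure_pLambda_add_one_eq_of_finrank_glAnn_le` with the stabiliser bound now proved.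
[cite: LandsbergManivelRessayre2013, Proposition 3.5.1 (p. 481)] -/
theorem affineDimension_orbitClosure_pLambda_add_one {n : ℕ} (hn : Odd n) (h3 : 3 ≤ n) :
    affineDimension (formCoeff n '' orbitClosure (pLambda n)) + 1 =
      affineDimension (formCoeff n '' orbitClosure (detPoly (Fin n) ℂ)) :=
  affineDimension_orbitClosure_pLambda_add_one_eq_of_finrank_glAnn_le hn h3
    (by rw [finrank_glAnn_pLambda_eq_finrank_glAnn_detPoly_add_one hn h3])

/-- **`dim \overline{GL(W)·P_Λ} = n⁴ + 1 − 2n²`** (affine cone, degree-`n` coefficient picture) for every odd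
`n ≥ 3`: `affineDimension_orbitClosure_eq_finrank_glTangent` and `finrank_glTangent_pLambda` (compare
`dim \overline{GL(W)·det_n} = n⁴ + 2 − 2n²`, `Bur24_dim_detOrbitClosure_holds`).
[cite: LandsbergManivelRessayre2013, Proposition 3.5.1 (p. 481)] [cite: Burgisser2024Completeness, §7.2] -/
theorem affineDimension_orbitClosure_pLambda {n : ℕ} (hn : Odd n) (h3 : 3 ≤ n) :
    affineDimension (formCoeff n '' orbitClosure (pLambda n)) = n ^ 4 + 1 - 2 * n ^ 2 := by
  rw [affineDimension_orbitClosure_eq_finrank_glTangent (pLambda_isHomogeneous hn), finrank_glTangent_pLambda hn h3]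

/-- **`dim ℂ[\overline{GL(W)·P_Λ}] = n⁴ + 1 − 2n²`**: the Krull dimension of the orbit-closure coordinate ring
`OrbitCoordRing (pLambda n) n`, every odd `n ≥ 3` (the `P_Λ` twin of `Bur24_dim_detOrbitClosure_holds`).
[cite: LandsbergManivelRessayre2013, Proposition 3.5.1 (p. 481)] [cite: Burgisser2024Completeness, §7.2] -/
theorem ringKrullDim_orbitCoordRing_pLambda {n : ℕ} (hn : Odd n) (h3 : 3 ≤ n) :
    ringKrullDim (OrbitCoordRing (pLambda n) n) = ((n ^ 4 + 1 - 2 * n ^ 2 : ℕ) : WithBot ℕ∞) := by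
  rw [ringKrullDim_orbitCoordRing_eq_affineDimension_orbitClosure (pLambda_isHomogeneous hn),
    affineDimension_orbitClosure_pLambda hn h3]

end Literature.Computability.AlgebraicComplexity

end
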